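import Mathlib
import Summits.Ventures.PercRepro.TriangleCapThreeBandBase

/-!
# PercRepro — THE ROW `a = 3`, EVERY SUB-DIAGONAL `r`, EVERY DEGREE `≥ 3`: THE CONVEXITY BOUND (p3, gen 40;
part 152)

Part 149 with a symbolic `r`: on the cell `m = 3k − 9 − r` (`k = r + 6 + j`) with every degree `≥ 3` the
excesses `f(v) = d(v) − 3` sum to `s = r + 3j`, the largest excess is `M ≤ k − 5 = r + 1 + j`, every other
excess satisfies `f(v) + M ≤ 2k − 12 = 2r + 2j`, and
`M² + Σ_{v ≠ x*} f(v)² ≤ 2r² + r + 4rj + 3j² = mk − r(k − 1 − r) − 6s − 9k`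
(`convexity_closing_gen`: the branch `M ≤ r + j` gives `M s ≤ (r + j)(r + 3j)`, the branch `M = r + 1 + j`
gives `(r + 1 + j)² + (r + j − 1)(2j − 1)`; the differences are `r² + r` and `r² + j − 2`).
So `Σ_v d(v)² + r (k − 1 − r) ≤ m k` (`three_band_stability_of_min_degree`, `r ≥ 2`). Axioms: standard.
-/

namespace PercRepro

namespace TriangleCap

namespace C047

open Finset

variable {V : Type*} [Fintype V] [DecidableEq V]

/-- **THE CONVEXITY CLOSING WITH A SYMBOLIC `r`:** `M + s' = r + 3j`, `M ≤ r + 1 + j`, `q ≤ M s'`,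
`q + M s' ≤ (2r + 2j) s'` ⇒ `M² + q ≤ 2r² + r + 4rj + 3j²` (for `r ≥ 2`). -/
theorem convexity_closing_gen (r j M s' q : ℕ) (hr : 2 ≤ r) (hMs : M + s' = r + 3 * j) (hM : M ≤ r + 1 + j)
    (hA : q ≤ M * s') (hB : q + M * s' ≤ (2 * r + 2 * j) * s') :
    M * M + q ≤ 2 * r * r + r + 4 * r * j + 3 * j * j := by
  rcases Nat.lt_or_ge M (r + 1 + j) with h5 | h6
  · have h1 : M * M + q ≤ M * (M + s') := by rw [Nat.mul_add]; omega
    rw [hMs] at h1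
    have h2 : M * (r + 3 * j) ≤ (r + j) * (r + 3 * j) := Nat.mul_le_mul_right _ (by omega)
    nlinarith
  · have hM6 : M = r + 1 + j := by omega
    subst hM6
    have hs : s' + 1 = 2 * j := by omega
    obtain ⟨j', rfl⟩ : ∃ j', j = j' + 1 := ⟨j - 1, by omega⟩
    have hs' : s' = 2 * j' + 1 := by omega
    subst hs'
    nlinarith

/-- **THE ROW `a = 3`, EVERY DEGREE `≥ 3`:** `K₄⁻`-free, `r ≥ 2`, `6 + r ≤ k`, `m + 9 + r = 3k`, every degree
`≥ 3` ⇒ `Σ_v d(v)² + r (k − 1 − r) ≤ m k`. -/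
theorem three_band_stability_of_min_degree (D : SimpleGraph V) [DecidableRel D.Adj] (hK : K4mFree D) (r : ℕ)
    (hr : 2 ≤ r) (hk : 6 + r ≤ Fintype.card V) (hm : D.edgeFinset.card + 9 + r = 3 * Fintype.card V)
    (hdeg : ∀ z, 3 ≤ deg D z) :
    ∑ v, deg D v * deg D v + r * (Fintype.card V - 1 - r) ≤ D.edgeFinset.card * Fintype.card V := by
  have hsum := sum_deg_eq D
  obtain ⟨x, -, hx⟩ := exists_max_image univ (deg D) (card_pos.mp (by rw [card_univ]; omega))
  obtain ⟨f, hf⟩ : ∃ f : V → ℕ, ∀ v, deg D v = f v + 3 :=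
    ⟨fun v => deg D v - 3, fun v => (Nat.sub_add_cancel (hdeg v)).symm⟩
  have e1 : ∑ v, deg D v = ∑ v, f v + 3 * Fintype.card V := by
    rw [sum_congr rfl (fun v _ => hf v), sum_add_distrib, sum_const, smul_eq_mul, card_univ]
    ring
  have e2 : ∀ v, deg D v * deg D v = f v * f v + 6 * f v + 9 := fun v => by rw [hf v]; ring
  have e3 : ∑ v, deg D v * deg D v = ∑ v, f v * f v + 6 * ∑ v, f v + 9 * Fintype.card V := by
    rw [sum_congr rfl (fun v _ => e2 v), sum_add_distrib, sum_add_distrib, ← mul_sum, sum_const, smul_eq_mul,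
      card_univ]
    ring
  -- the largest excess and the pair bound
  have hM : ∀ v, f v ≤ f x := fun v => by have := hx v (mem_univ v); rw [hf v, hf x] at this; omega
  have hMk : f x + 5 ≤ Fintype.card V := by
    have := deg_add_two_le_card_of_dense D hK (by omega) x
    rw [hf x] at this
    omega
  have hP : ∀ v, v ≠ x → f v + f x + 12 ≤ 2 * Fintype.card V := by
    intro v hv
    have := deg_add_deg_add_six_le D hK (by omega) (by omega) hv
    rw [hf v, hf x] at this
    omega
  have hsq := add_sum_erase univ (fun v => f v * f v) (mem_univ x)
  have hs := add_sum_erase univ f (mem_univ x)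
  have hA := sum_erase_sq_le_mul f x (f x) hM
  have hB := sum_erase_sq_add_le f x (f x) (2 * Fintype.card V - 12) (fun v hv => by have := hP v hv; omega)
  -- the arithmetic: `k = r + 6 + j`, `m = 2r + 9 + 3j`
  obtain ⟨j, hj⟩ : ∃ j, Fintype.card V = r + 6 + j := ⟨Fintype.card V - (r + 6), by omega⟩
  have hmj : D.edgeFinset.card = 2 * r + 9 + 3 * j := by omega
  rw [e3, hmj, hj]
  have e4 : r + 6 + j - 1 - r = j + 5 := by omega
  rw [e4]
  have e5 : 2 * (r + 6 + j) - 12 = 2 * r + 2 * j := by omega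
  rw [hj, e5] at hB
  rw [hj] at hMk e1
  rw [hmj] at hsum
  generalize hq : ∑ v ∈ univ.erase x, f v * f v = q at hsq hA hB
  generalize hs' : ∑ v ∈ univ.erase x, f v = s' at hs hA hB
  generalize hM' : f x = M at hsq hs hA hB hMk
  rw [← hsq, ← hs]
  have hMs : M + s' = r + 3 * j := by omega
  have hclose := convexity_closing_gen r j M s' q hr hMs (by omega) hA hB
  nlinarith

end C047

end TriangleCap

end PercRepro
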